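import Summits.AnomalousDissipation.AnomalousDissipation.Theorems.SolenoidalFractalHomogenisationLagrangianStepVmodFrameDefs
import HarnessLib

/-!
# K1L_D (stmt-AnomalousDissipation-27980), v2 of the (ℓ3) propagator spec: `IsDistortedPropagatorS := IsDistortedPropagator ∧ exists_sol`
# — the ONE-BINDER AMENDMENT approved in advance by tenure RULING D28-10 (c) (memo L22 §4 step (5); prover lead-k1l-onelevel-p1 g7)
(Summits-side definitions file of route `SolenoidalFractalHomogenisation`; review lane.)

CONVENTION (D28-8′ line-1 rule): derivative-index distortion (`Torus.Visc4.conj`, `viscAdjVar`), class variable `v = u ∘ X`, constraint `∇·(G v) = 0`.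

WHAT CHANGES.  `CellClauseMod.IsDistortedPropagator Tw 𝔸 b G U` (p711553-era spec: contraction, cocycle, identity on `G(s)`-solenoidal data,
`G(t)`-solenoidal range, vanishing on the orthogonal complement, weak continuity, REPRESENTATION of every distorted weak solution) has no EXISTENCE
clause: `repr` identifies `U s (s+·) φ` with any distorted weak solution from `φ`, but nothing in the spec says one exists, so a block prover who wants
the y-side DYNAMICS of `U` (the distorted weak form — the leak decomposition of (M_θ), every (ℓ3-B) modal argument) cannot get it from the binder.
**`IsDistortedPropagatorS`** = `IsDistortedPropagator` EXTENDED by the field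
`exists_sol : ∀ s, 0 ≤ s → s < Tw → ∀ φ (hφ : MemLp φ 2 volume), ∇·(G(s) φ) = 0 weakly → ∃ w, IsWeakTensorPassiveVectorDistortedOn 0 (Tw − s) 𝔸 (b (s+·)) (G (s+·)) φ w`
(spelled EXACTLY as the interim local hypothesis `hsol` of memo L22 §4 / RULING D28-10 (c)).  For the one instance ever instantiated — the conjugate
propagators of the true and the coarse member along the clamped exact-flow frame — the field is PROVED (`FrameConj.exists_sol_true/_coarse`,
`…LagrangianStepFrameExistsSol`: Lions' Eulerian existence ∘ time dilation ∘ the converse reading `isWeakTensorPassiveVectorDistortedOn_of_eulerian`,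
`…LagrangianStepFrameFromEulerian`, itself resting on the v2-road files `…FrameBackward/Entries/Lipschitz`, `…FrameChainRuleAE/Frame`).

WHY A NEW LEAF FILE (as for `…VmodFrameDefs`): the texts of record are imported by the live (ℓ2)/(ℓ3) lanes; nothing existing is touched; every
declaration below is the landed F-text VERBATIM with the single token change `IsDistortedPropagator ↦ IsDistortedPropagatorS` in the propagator binders.
Since the binders are HYPOTHESES of the texts, the FS-texts are WEAKER than the F-texts (`modECW0FS_of_modECW0F`, `blockBoundGFS_of_blockBoundGF`,
`nearMultGFS_of_nearMultGF` below: one-liners through `IsDistortedPropagatorS.toIsDistortedPropagator`), and the head must supply S-instances — which it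
can (`…FrameConjugacyFS`, `…Z7GlueEulerXOfVRH0FS`: `vmod_EX_of_VRH0FS`).  Binder order, constants, error functional, `IsSlow`/`IsFast`, reset anchoring
(D28-9 CONDITION) — VERBATIM.

Contents: §1 `CellClauseMod.IsDistortedPropagatorS`; §2 `VmodDist.SlowVectorClauseModECW0FS`, `BlockBoundGFS`, `NearMultGFS` + the three weakenings;
§3 `Z7Glue.FrameConjugacyAtFS` + `FrameConjugacyAtFS.toFrameConjugacyAtF`.
Definitions + trivial bridges only; NOT a proof of (M_θ), of any block, of `stub_Vmod_EHTthg`, of K1L_D or of AD; rung F-D1.A0.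
-/

set_option linter.dupNamespace false

noncomputable section

namespace Summit.AnomalousDissipation.AnomalousDissipation.Theorems.SolenoidalFractalHomogenisation.LagrangianStep.CellClauseMod

open Literature.Analysis Literature.Analysis.FluidPDE Literature.Analysis.FunctionSpaces
open MeasureTheory Set Filter UnitAddTorus
open scoped ENNReal NNReal InnerProductSpace

/-! ## §1 The v2 propagator spec -/

/-- **The propagator spec over the DISTORTED class, v2 (`IsDistortedPropagator ∧ exists_sol`).**  `IsDistortedPropagator` (contraction, cocycle,
identity at `s = t` on `G(s)`-solenoidal data, `G(t)`-solenoidal range, vanishing on the orthogonal complement of the `G(s)`-solenoidal classes,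
weak continuity, representation of every distorted weak solution) EXTENDED by EXISTENCE: from every `L²` datum `φ` with `∇·(G(s) φ) = 0` weakly
there IS a distorted weak solution on `(0, Tw − s)` along `τ ↦ b (s+τ)`, `τ ↦ G (s+τ)` (which `repr` then identifies with `τ ↦ U s (s+τ) φ`).
(Tenure RULING D28-10 (c); the one instance is discharged by `FrameConj.exists_sol_true/_coarse`.) -/
structure IsDistortedPropagatorS (Tw : ℝ) (𝔸 : Torus.Visc4 (Fin 3)) (b : ℝ → VF)
    (G : ℝ → UnitAddTorus (Fin 3) → Matrix (Fin 3) (Fin 3) ℝ) (U : ℝ → ℝ → (V2 →L[ℝ] V2)) : Prop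
    extends IsDistortedPropagator Tw 𝔸 b G U where
  exists_sol : ∀ (s : ℝ), 0 ≤ s → s < Tw → ∀ (φ : VF), MemLp φ 2 volume → Torus.IsWeaklyDivFree (Torus.distort (G s) φ) →
    ∃ w : ℝ → VF, Torus.IsWeakTensorPassiveVectorDistortedOn 0 (Tw - s) 𝔸 (fun τ => b (s + τ)) (fun τ => G (s + τ)) φ w

end Summit.AnomalousDissipation.AnomalousDissipation.Theorems.SolenoidalFractalHomogenisation.LagrangianStep.CellClauseMod

namespace Summit.AnomalousDissipation.AnomalousDissipation.Theorems.SolenoidalFractalHomogenisation.LagrangianStep.VmodDist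

open Literature.Analysis Literature.Analysis.FluidPDE Literature.Analysis.FunctionSpaces
open MeasureTheory Set Filter UnitAddTorus
open scoped ENNReal NNReal InnerProductSpace
open Summit.AnomalousDissipation.AnomalousDissipation.Theorems.SolenoidalFractalHomogenisation.LagrangianStep.CellClauseMod
open Summit.AnomalousDissipation.AnomalousDissipation.Theorems.SolenoidalFractalHomogenisation.LagrangianStep.LossCurrency
open Summit.AnomalousDissipation.AnomalousDissipation.Theorems.SolenoidalFractalHomogenisation.LagrangianStep.VmodFlat
  (IsSlow IsFast fc fc_sub inner_eq_zero_of_fc_disjoint eta_sum_le)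

/-! ## §2 The (ℓ3)-internal texts over the class of record, v2 propagator spec -/

/-- **(V_modECW0FS)** — `SlowVectorClauseModECW0F` VERBATIM except `IsDistortedPropagator ↦ IsDistortedPropagatorS` (v2 spec, D28-10 (c)).
[cite: ArmstrongVicol2025, §4.1 (PDF p. 34: the distortion-adapted comparison problem)] -/
def SlowVectorClauseModECW0FS {k : ℕ} (W : LatticeShear.LatticeWord k) (M : ℝ) (hM : 0 < M) (c : ℝ)
    (Φ : ℝ → Torus.Visc4 (Fin 3) → Torus.Visc4 (Fin 3)) (lo hi Λ β σ C ν₀ K θ₁ ϱ₁ : ℝ) : Prop :=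
  ∀ ν, ∀ hν : ν ∈ Set.Ioo 0 ν₀, ∀ n : ℕ, (⌈K / ν⌉₊ : ℝ) ≤ n → ∀ 𝔸 : Torus.Visc4 (Fin 3),
    Torus.OddSmall 𝔸 (ν * β) → (∃ lam ∈ Set.Icc (1:ℝ) Λ, Torus.NearIso 𝔸 (ν * (lo / lam)) (ν * (hi * lam))) →
    Torus.OddSmall (Φ ν ((1 / ν) • 𝔸)) β → (∃ lam ∈ Set.Icc (1:ℝ) Λ, Torus.NearIso (Φ ν ((1 / ν) • 𝔸)) (lo / lam) (hi * lam)) →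
    ∀ θ ∈ Set.Icc 0 θ₁, ∀ nC : ℝ, 0 ≤ nC → nC ≤ ϱ₁ * n → ∀ Tw > (0:ℝ),
    ∀ G : ℝ → UnitAddTorus (Fin 3) → Matrix (Fin 3) (Fin 3) ℝ, IsFrameModulation θ Tw nC G →
    ∀ U T : ℝ → ℝ → (V2 →L[ℝ] V2),
      IsDistortedPropagatorS Tw ((1 / (n:ℝ) ^ 2) • 𝔸) (cellField W M hM ν hν.1 n) G U →
      IsDistortedPropagatorS Tw ((1 / (n:ℝ) ^ 2) • (𝔸 + (c / ν) • Φ ν ((1 / ν) • 𝔸))) (fun _ _ => 0) G T →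
    ∀ t : ℝ, 0 < t → t ≤ Tw → ∀ x ζ : V2,
      |⟪U 0 t x - T 0 t x, ζ⟫_ℝ|
        ≤ (C * (C * (ν ^ σ + ((⌈K / ν⌉₊ : ℝ) / n) ^ σ + θ ^ σ + (nC / n) ^ σ) + (min 1 ((M * W.period / ν) / t)) ^ σ))
          * Real.sqrt (lossFwd (T 0 t) x) * Real.sqrt (lossAdj (T 0 t) ζ)

/-- **The distorted block shape over the class of record, v2 spec** — `BlockBoundGF` VERBATIM except `IsDistortedPropagator ↦ IsDistortedPropagatorS`. -/
def BlockBoundGFS {k : ℕ} (W : LatticeShear.LatticeWord k) (M : ℝ) (hM : 0 < M) (c : ℝ)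
    (Φ : ℝ → Torus.Visc4 (Fin 3) → Torus.Visc4 (Fin 3)) (lo hi Λ β σ Cb ν₀ K θ₁ ϱ₁ : ℝ) (Px Pζ : ℕ → V2 → Prop) : Prop :=
  ∀ ν, ∀ hν : ν ∈ Set.Ioo 0 ν₀, ∀ n : ℕ, (⌈K / ν⌉₊ : ℝ) ≤ n → ∀ 𝔸 : Torus.Visc4 (Fin 3),
    Torus.OddSmall 𝔸 (ν * β) → (∃ lam ∈ Set.Icc (1:ℝ) Λ, Torus.NearIso 𝔸 (ν * (lo / lam)) (ν * (hi * lam))) →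
    Torus.OddSmall (Φ ν ((1 / ν) • 𝔸)) β → (∃ lam ∈ Set.Icc (1:ℝ) Λ, Torus.NearIso (Φ ν ((1 / ν) • 𝔸)) (lo / lam) (hi * lam)) →
    ∀ θ ∈ Set.Icc 0 θ₁, ∀ nC : ℝ, 0 ≤ nC → nC ≤ ϱ₁ * n → ∀ Tw > (0:ℝ),
    ∀ G : ℝ → UnitAddTorus (Fin 3) → Matrix (Fin 3) (Fin 3) ℝ, IsFrameModulation θ Tw nC G →
    ∀ U T : ℝ → ℝ → (V2 →L[ℝ] V2),
      IsDistortedPropagatorS Tw ((1 / (n:ℝ) ^ 2) • 𝔸) (cellField W M hM ν hν.1 n) G U →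
      IsDistortedPropagatorS Tw ((1 / (n:ℝ) ^ 2) • (𝔸 + (c / ν) • Φ ν ((1 / ν) • 𝔸))) (fun _ _ => 0) G T →
    ∀ t : ℝ, 0 < t → t ≤ Tw → ∀ x ζ : V2, Px n x → Pζ n ζ →
      |⟪U 0 t x - T 0 t x, ζ⟫_ℝ|
        ≤ (Cb * (Cb * (ν ^ σ + ((⌈K / ν⌉₊ : ℝ) / n) ^ σ + θ ^ σ + (nC / n) ^ σ) + (min 1 ((M * W.period / ν) / t)) ^ σ))
          * Real.sqrt (lossFwd (T 0 t) x) * Real.sqrt (lossAdj (T 0 t) ζ)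

/-- **(M_θ) over the class of record, v2 spec** — `NearMultGF` VERBATIM except `IsDistortedPropagator ↦ IsDistortedPropagatorS`. -/
def NearMultGFS (c : ℝ) (Φ : ℝ → Torus.Visc4 (Fin 3) → Torus.Visc4 (Fin 3)) (lo hi Λ β ν₀ K θ₁ ϱ₁ κ : ℝ) : Prop :=
  ∀ ν : ℝ, ν ∈ Set.Ioo 0 ν₀ → ∀ n : ℕ, (⌈K / ν⌉₊ : ℝ) ≤ n → ∀ 𝔸 : Torus.Visc4 (Fin 3),
    Torus.OddSmall 𝔸 (ν * β) → (∃ lam ∈ Set.Icc (1:ℝ) Λ, Torus.NearIso 𝔸 (ν * (lo / lam)) (ν * (hi * lam))) →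
    Torus.OddSmall (Φ ν ((1 / ν) • 𝔸)) β → (∃ lam ∈ Set.Icc (1:ℝ) Λ, Torus.NearIso (Φ ν ((1 / ν) • 𝔸)) (lo / lam) (hi * lam)) →
    ∀ θ ∈ Set.Icc 0 θ₁, ∀ nC : ℝ, 0 ≤ nC → nC ≤ ϱ₁ * n → ∀ Tw > (0:ℝ),
    ∀ G : ℝ → UnitAddTorus (Fin 3) → Matrix (Fin 3) (Fin 3) ℝ, IsFrameModulation θ Tw nC G →
    ∀ T : ℝ → ℝ → (V2 →L[ℝ] V2),
      IsDistortedPropagatorS Tw ((1 / (n:ℝ) ^ 2) • (𝔸 + (c / ν) • Φ ν ((1 / ν) • 𝔸))) (fun _ _ => 0) G T →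
    ∀ t : ℝ, 0 < t → t ≤ Tw →
      (∀ xs xf : V2, IsSlow n xs → IsFast n xf →
        |⟪T 0 t xs, T 0 t xf⟫_ℝ| ≤ κ * Real.sqrt (lossFwd (T 0 t) xs) * Real.sqrt (lossFwd (T 0 t) xf)) ∧
      (∀ ζs ζf : V2, IsSlow n ζs → IsFast n ζf →
        |⟪ContinuousLinearMap.adjoint (T 0 t) ζs, ContinuousLinearMap.adjoint (T 0 t) ζf⟫_ℝ|
          ≤ κ * Real.sqrt (lossAdj (T 0 t) ζs) * Real.sqrt (lossAdj (T 0 t) ζf))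

/-- Weakening: the landed F-text implies the FS-text (S-propagators are F-propagators). -/
theorem modECW0FS_of_modECW0F {k : ℕ} {W : LatticeShear.LatticeWord k} {M : ℝ} {hM : 0 < M} {c : ℝ}
    {Φ : ℝ → Torus.Visc4 (Fin 3) → Torus.Visc4 (Fin 3)} {lo hi Λ β σ C ν₀ K θ₁ ϱ₁ : ℝ}
    (h : SlowVectorClauseModECW0F W M hM c Φ lo hi Λ β σ C ν₀ K θ₁ ϱ₁) : SlowVectorClauseModECW0FS W M hM c Φ lo hi Λ β σ C ν₀ K θ₁ ϱ₁ :=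
  fun ν hν n hn 𝔸 hodd hwin hΦo hΦw θ hθ nC hnC0 hnC Tw hTw G hG U T hU hT =>
    h ν hν n hn 𝔸 hodd hwin hΦo hΦw θ hθ nC hnC0 hnC Tw hTw G hG U T hU.toIsDistortedPropagator hT.toIsDistortedPropagator

/-- Weakening for the blocks. -/
theorem blockBoundGFS_of_blockBoundGF {k : ℕ} {W : LatticeShear.LatticeWord k} {M : ℝ} {hM : 0 < M} {c : ℝ}
    {Φ : ℝ → Torus.Visc4 (Fin 3) → Torus.Visc4 (Fin 3)} {lo hi Λ β σ Cb ν₀ K θ₁ ϱ₁ : ℝ} {Px Pζ : ℕ → V2 → Prop}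
    (h : BlockBoundGF W M hM c Φ lo hi Λ β σ Cb ν₀ K θ₁ ϱ₁ Px Pζ) : BlockBoundGFS W M hM c Φ lo hi Λ β σ Cb ν₀ K θ₁ ϱ₁ Px Pζ :=
  fun ν hν n hn 𝔸 hodd hwin hΦo hΦw θ hθ nC hnC0 hnC Tw hTw G hG U T hU hT =>
    h ν hν n hn 𝔸 hodd hwin hΦo hΦw θ hθ nC hnC0 hnC Tw hTw G hG U T hU.toIsDistortedPropagator hT.toIsDistortedPropagator

/-- Weakening for (M_θ). -/
theorem nearMultGFS_of_nearMultGF {c : ℝ} {Φ : ℝ → Torus.Visc4 (Fin 3) → Torus.Visc4 (Fin 3)} {lo hi Λ β ν₀ K θ₁ ϱ₁ κ : ℝ}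
    (h : NearMultGF c Φ lo hi Λ β ν₀ K θ₁ ϱ₁ κ) : NearMultGFS c Φ lo hi Λ β ν₀ K θ₁ ϱ₁ κ :=
  fun ν hν n hn 𝔸 hodd hwin hΦo hΦw θ hθ nC hnC0 hnC Tw hTw G hG T hT =>
    h ν hν n hn 𝔸 hodd hwin hΦo hΦw θ hθ nC hnC0 hnC Tw hTw G hG T hT.toIsDistortedPropagator

end Summit.AnomalousDissipation.AnomalousDissipation.Theorems.SolenoidalFractalHomogenisation.LagrangianStep.VmodDist

/-! ## §3 `FrameConjugacyAtFS` -/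

namespace Summit.AnomalousDissipation.AnomalousDissipation.Theorems.SolenoidalFractalHomogenisation.LagrangianStep.Z7Glue

open Literature.Analysis Literature.Analysis.FluidPDE Literature.Analysis.FunctionSpaces
open MeasureTheory Set
open scoped InnerProductSpace
open Literature.Analysis.FluidPDE.LatticeShear (LagrangianLatticeCarrier LatticeWord)
open Summit.AnomalousDissipation.AnomalousDissipation.Theorems.SolenoidalFractalHomogenisation.LagrangianStep.CellClauseMod

/-- **`FrameConjugacyAtFS`** — `FrameConjugacyAtF` VERBATIM except that the two hidden distorted propagators satisfy the v2 spec
`IsDistortedPropagatorS` (existence of distorted weak solutions included). -/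
def FrameConjugacyAtFS {k : ℕ} (W : LatticeWord k) (M : ℝ) (hM : 0 < M) (c : ℝ) (Φ : ℝ → Torus.Visc4 (Fin 3) → Torus.Visc4 (Fin 3))
    (Cα ϱ : ℝ) (E : LagrangianLatticeCarrier k) (m : ℕ) (S : Torus.Visc4 (Fin 3)) (Um1 Um : ℝ → ℝ → (V2 →L[ℝ] V2)) (s t : ℝ) : Prop :=
  ∃ hν : E.cellVisc (m + 1) ∈ Set.Ioo 0 (E.cellVisc (m + 1) + 1),
  ∃ θ : ℝ, 0 ≤ θ ∧ θ ≤ Cα * E.θ (m + 1) ∧ ∃ nC : ℝ, 0 ≤ nC ∧ nC ≤ ϱ * E.N m ∧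
  ∃ G : ℝ → UnitAddTorus (Fin 3) → Matrix (Fin 3) (Fin 3) ℝ, IsFrameModulation θ (E.a (m + 1) * (t - s)) nC G ∧
  ∃ Ut Tt : ℝ → ℝ → (V2 →L[ℝ] V2),
    IsDistortedPropagatorS (E.a (m + 1) * (t - s)) ((1 / (E.N (m + 1) : ℝ) ^ 2) • (E.cellVisc (m + 1) • S))
      (cellField W M hM (E.cellVisc (m + 1)) hν.1 (E.N (m + 1))) G Ut ∧
    IsDistortedPropagatorS (E.a (m + 1) * (t - s)) ((1 / (E.N (m + 1) : ℝ) ^ 2) • (E.cellVisc (m + 1) • S +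
      (c / E.cellVisc (m + 1)) • Φ (E.cellVisc (m + 1)) ((1 / E.cellVisc (m + 1)) • (E.cellVisc (m + 1) • S)))) (fun _ _ => 0) G Tt ∧
  ∃ ι ι' : V2 → V2,
    (∀ x y : V2, Torus.IsWeaklyDivFree (⇑x : VF) → Torus.IsWeaklyDivFree (⇑y : VF) →
      ⟪Um1 s t x - Um s t x, y⟫_ℝ
        = ⟪Ut 0 (E.a (m + 1) * (t - s)) (ι x) - Tt 0 (E.a (m + 1) * (t - s)) (ι x), ι' y⟫_ℝ) ∧
    (∀ x : V2, Torus.IsWeaklyDivFree (⇑x : VF) → lossFwd (Tt 0 (E.a (m + 1) * (t - s))) (ι x) = lossFwd (Um s t) x) ∧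
    (∀ y : V2, Torus.IsWeaklyDivFree (⇑y : VF) → lossAdj (Tt 0 (E.a (m + 1) * (t - s))) (ι' y) = lossAdj (Um s t) y)

/-- The FS-conjugacy forgets to the F-conjugacy. -/
theorem FrameConjugacyAtFS.toFrameConjugacyAtF {k : ℕ} {W : LatticeWord k} {M : ℝ} {hM : 0 < M} {c : ℝ}
    {Φ : ℝ → Torus.Visc4 (Fin 3) → Torus.Visc4 (Fin 3)} {Cα ϱ : ℝ} {E : LagrangianLatticeCarrier k} {m : ℕ} {S : Torus.Visc4 (Fin 3)}
    {Um1 Um : ℝ → ℝ → (V2 →L[ℝ] V2)} {s t : ℝ} (h : FrameConjugacyAtFS W M hM c Φ Cα ϱ E m S Um1 Um s t) :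
    FrameConjugacyAtF W M hM c Φ Cα ϱ E m S Um1 Um s t := by
  obtain ⟨hν, θ, hθ0, hθle, nC, hnC0, hnCle, G, hG, Ut, Tt, hUt, hTt, ι, ι', hconj, hlossF, hlossA⟩ := h
  exact ⟨hν, θ, hθ0, hθle, nC, hnC0, hnCle, G, hG, Ut, Tt, hUt.toIsDistortedPropagator, hTt.toIsDistortedPropagator, ι, ι', hconj, hlossF, hlossA⟩

end Summit.AnomalousDissipation.AnomalousDissipation.Theorems.SolenoidalFractalHomogenisation.LagrangianStep.Z7Glue

end
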